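import Literature.NumberTheory.Automorphic.ClozelAlgebraicity
import Literature.NumberTheory.Automorphic.ClozelAlgebraicityRatFieldProofs
import HarnessLib

/-!
# Clozel's algebraicity fact: purity on multisets gives a pure infinity type (proofs)

Proofs-only companion (theorems, no definitions, no named facts) of `ClozelAlgebraicity.lean`.
Clause (iii) of `Clozel1990_regularAlgebraic` renders Clozel's lemme de pureté (Clozel 1990,
Lemme 4.9: the characters `z^{p_i} z̄^{q_i}` of `π_∞` satisfy `p_i + q_i = w`) on the multisets
read by `HasInfinityType`: for every regular algebraic infinity type `T` of `π` there is `w ∈ ℤ`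
with `{a-multiset of T at ῑ} = {w − a : a ∈ a-multiset of T at ι}`. This file shows that nothing
printed is lost in that rendering: from the multiset statement one recovers an infinity type of
`π` that is pure AS PAIRS, `a + b = w` for every weight — the printed shape of Lemme 4.9 —
by re-pairing every `a` with `w − a`:

* `InfinityType.exists_pure_of_map_a` — a well-formed C-algebraic `T` whose `a`-multisets
  satisfy purity of weight `w` admits a well-formed C-algebraic `T'` with the same `a`-multisets
  at every embedding and `a + b = w` for all its weights (`T' ι = {(a, w − a) : a ∈ T ι}`; the
  side condition `a − b = 2a − w ∈ ℤ` holds as `a ∈ (n−1)/2 + ℤ`; conjugation symmetry of `T'`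
  is exactly the multiset purity hypothesis);
* `AutomorphicRepData.HasInfinityType.of_map_a_eq` — `HasInfinityType` only reads
  well-formedness and the `a`-multisets, so such a `T'` is again an infinity type of `π`;
* `Clozel1990_regularAlgebraic.exists_pure_infinityType` — under the fact, a cuspidal regular
  algebraic `π` has a regular algebraic infinity type `T` and `w ∈ ℤ` with `a + b = w` for
  every weight `(a, b)` of `T` at every embedding (Clozel 1990, Lemme 4.9 as printed).

## References

* L. Clozel, *Motifs et formes automorphes: applications du principe de fonctorialité*, in
  Automorphic forms, Shimura varieties, and L-functions I (Ann Arbor 1988), Academic Press 1990,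
  Lemme 4.9 (lemme de pureté) and Thm. 3.13 [Clozel1990].
* S. Patrikis, *Variations on a theorem of Tate*, Mem. AMS 258 (2019) = arXiv:1207.6724, proof
  of Prop. 4.0.13 ("`Re(μ_{v,i} + ν_{v,i})` is independent of `i`") [Patrikis2019].
-/

noncomputable section

open scoped Classical
open NumberField

namespace Literature.NumberTheory.Automorphic

namespace InfinityType

variable {K : Type*} [Field K] {n : ℕ}

/-- **Purity on multisets gives a pure re-pairing.** Let `T` be well formed and C-algebraic and
let `w ∈ ℤ` satisfy `{a-multiset of T at ῑ} = {w − a : a ∈ a-multiset of T at ι}` for every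
embedding `ι`. Then `T' ι := {(a, w − a) : a ∈ a-multiset of T at ι}` is a well-formed
C-algebraic infinity type with the same `a`-multisets as `T` and `a + b = w` for all its weights
(the side condition `a − (w − a) = 2a − w ∈ ℤ` holds because `a ∈ (n−1)/2 + ℤ`; the symmetry
`T' ῑ = swap (T' ι)` is the hypothesis). (Clozel 1990, Lemme 4.9, read on multisets and back.)
[cite: Clozel1990, Lemme 4.9] -/
theorem exists_pure_of_map_a {T : InfinityType K n} (hwf : T.IsWellFormed) (hC : T.IsCAlgebraic)
    {w : ℤ} (hw : ∀ ι : K →+* ℂ, (T (ComplexEmbedding.conjugate ι)).map ArchWeight.a =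
      ((T ι).map ArchWeight.a).map fun a ↦ (w : ℂ) - a) :
    ∃ T' : InfinityType K n, T'.IsWellFormed ∧ T'.IsCAlgebraic ∧
      (∀ ι, (T' ι).map ArchWeight.a = (T ι).map ArchWeight.a) ∧
      ∀ ι, ∀ p ∈ T' ι, p.a + p.b = (w : ℂ) := by
  -- side condition `a - (w - a) ∈ ℤ` for the weights of `T`
  have hP : ∀ ι, ∀ p ∈ T ι, ∃ m : ℤ, p.a - ((w : ℂ) - p.a) = m := by
    intro ι p hp
    obtain ⟨k, -, hk, -⟩ := hC ι p hp
    exact ⟨2 * k + ((n : ℤ) - 1) - w, by rw [hk]; push_cast; ring⟩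
  -- the re-paired type `T' ι = {(a, w - a)}`
  obtain ⟨T', hT'⟩ : ∃ T' : InfinityType K n, ∀ ι, T' ι =
      (T ι).pmap (fun p h ↦ (⟨p.a, (w : ℂ) - p.a, h⟩ : ArchWeight)) (hP ι) :=
    ⟨fun ι ↦ (T ι).pmap (fun p h ↦ (⟨p.a, (w : ℂ) - p.a, h⟩ : ArchWeight)) (hP ι), fun _ ↦ rfl⟩
  -- coordinates `(a, b)` are injective on weights, and those of `T'` are `(a, w - a)`
  have hab : Function.Injective (fun p : ArchWeight ↦ (p.a, p.b)) := by
    intro p q hpq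
    simp only [Prod.mk.injEq] at hpq
    exact ArchWeight.ext hpq.1 hpq.2
  have hT'ab : ∀ ι, (T' ι).map (fun p : ArchWeight ↦ (p.a, p.b)) =
      ((T ι).map ArchWeight.a).map fun a ↦ (a, (w : ℂ) - a) := by
    intro ι
    rw [hT', Multiset.map_pmap]
    dsimp only
    rw [Multiset.pmap_eq_map, Multiset.map_map]
    rfl
  have ha : ∀ ι, (T' ι).map ArchWeight.a = (T ι).map ArchWeight.a := by
    intro ι
    have h := congrArg (Multiset.map Prod.fst) (hT'ab ι)
    simpa [Multiset.map_map, Function.comp_def] using h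
  refine ⟨T', ⟨fun ι ↦ ?_, fun ι ↦ ?_⟩, fun ι p hp ↦ ?_, ha, fun ι p hp ↦ ?_⟩
  · -- exactly `n` weights
    rw [← Multiset.card_map ArchWeight.a, ha ι, Multiset.card_map]
    exact hwf.1 ι
  · -- conjugation symmetry = multiset purity
    apply Multiset.map_injective hab
    have h1 : ((T' ι).map ArchWeight.swap).map (fun p : ArchWeight ↦ (p.a, p.b)) =
        ((T' ι).map (fun p : ArchWeight ↦ (p.a, p.b))).map Prod.swap := by
      simp only [Multiset.map_map]
      rfl
    rw [h1, hT'ab ι, hT'ab, hw ι]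
    simp only [Multiset.map_map, Function.comp_def, Prod.swap_prod_mk, sub_sub_cancel]
  · -- C-algebraic: `a ∈ (n-1)/2 + ℤ` and `b = w - a`
    rw [hT'] at hp
    obtain ⟨p₀, hp₀, rfl⟩ := Multiset.mem_pmap.mp hp
    obtain ⟨k, -, hk, -⟩ := hC ι p₀ hp₀
    refine ⟨k, w - k - ((n : ℤ) - 1), hk, ?_⟩
    change (w : ℂ) - p₀.a = _
    rw [hk]
    push_cast
    ring
  · -- pure as pairs
    rw [hT'] at hp
    obtain ⟨p₀, hp₀, rfl⟩ := Multiset.mem_pmap.mp hp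
    change p₀.a + ((w : ℂ) - p₀.a) = w
    ring

end InfinityType

section Consequences

variable {n : ℕ} {K : Type} [Field K] [NumberField K] {hcpt : isCompact_glFiniteIntegralLevel n K}

/-- **`HasInfinityType` only reads well-formedness and the `a`-multisets**: an infinity type
with the same `a`-multisets as an infinity type of `π` is again an infinity type of `π`
(`π.HasArchParameter fun σ ↦ (T σ).map ArchWeight.a`). [folklore] -/
theorem AutomorphicRepData.HasInfinityType.of_map_a_eq
    {π : AutomorphicRepData (AutomorphyDatum.gl n K hcpt)} {T T' : InfinityType K n}
    (hT : π.HasInfinityType T) (hwf : T'.IsWellFormed)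
    (ha : ∀ κ, (T' κ).map ArchWeight.a = (T κ).map ArchWeight.a) : π.HasInfinityType T' := by
  have hfun : (fun κ ↦ (T' κ).map ArchWeight.a) = fun κ ↦ (T κ).map ArchWeight.a := funext ha
  refine ⟨hwf, ?_⟩
  rw [hfun]
  exact hT.2

/-- **Clozel's lemme de pureté in its printed shape, from the fact.** Under
`Clozel1990_regularAlgebraic`, a cuspidal regular algebraic `π` of `GL_n(𝔸_K)` has a regular
algebraic infinity type `T` and an integer `w` with `a + b = w` for every weight `(a, b)` of `T`
at every embedding: clause (iii) gives purity on the `a`-multisets of a regular algebraic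
infinity type of `π`, `InfinityType.exists_pure_of_map_a` re-pairs it into a pure type with the
same `a`-multisets, which `π` also has (`HasInfinityType.of_map_a_eq`). (Clozel 1990,
Lemme 4.9: `p_i + q_i = w` for the characters `z^{p_i} z̄^{q_i}` of `π_∞`.) [cite: Clozel1990, Lemme 4.9] -/
theorem Clozel1990_regularAlgebraic.exists_pure_infinityType (h : Clozel1990_regularAlgebraic)
    (π : CuspidalAutomorphicRepData n K hcpt) (hπ : π.1.IsRegularAlgebraic) :
    ∃ (T : InfinityType K n) (w : ℤ), π.1.HasInfinityType T ∧ T.IsRegularAlgebraic ∧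
      ∀ ι : K →+* ℂ, ∀ p ∈ T ι, p.a + p.b = (w : ℂ) := by
  obtain ⟨T, hT, hreg⟩ := hπ
  obtain ⟨w, hw⟩ := h.purity π hT hreg
  obtain ⟨T', hwf', hC', ha', hpure⟩ :=
    InfinityType.exists_pure_of_map_a hT.1 hreg.1 (w := w) fun ι ↦ hw ι
  exact ⟨T', w, hT.of_map_a_eq hwf' ha', ⟨hC', fun ι ↦ by rw [ha' ι]; exact hreg.2 ι⟩, hpure⟩

end Consequences

/-! ### The purity weight is determined by the `a`-multisets and is the same for the conjugates -/

namespace InfinityType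

variable {K : Type*} [Field K] [NumberField K] {n : ℕ}

/-- **The total `a`-sum of a pure infinity type**: if `T` has `n` weights at each embedding and
`{a-multiset at ῑ} = {w − a : a ∈ a-multiset at ι}` for every `ι` (purity on multisets, the
shape of clause (iii) of `Clozel1990_regularAlgebraic`), then
`2 ∑_ι ∑_{a ∈ T ι} a = n · #(K →+* ℂ) · w`: re-index the sum by the involution `ι ↦ ῑ` and use
`∑_{a ∈ T ῑ} a = n w − ∑_{a ∈ T ι} a`. (For the genuine type, `a_{ι,i} + b_{ι,i} = w` summed over
all `(ι, i)`; Clozel 1990, Lemme 4.9.) [cite: Clozel1990, Lemme 4.9] -/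
theorem two_mul_sum_sum_a_eq_of_pure {T : InfinityType K n}
    (hcard : ∀ ι : K →+* ℂ, Multiset.card (T ι) = n) {w : ℤ}
    (hw : ∀ ι : K →+* ℂ, (T ((starRingEnd ℂ).comp ι)).map ArchWeight.a =
      ((T ι).map ArchWeight.a).map fun a ↦ (w : ℂ) - a) :
    2 * ∑ ι : K →+* ℂ, ((T ι).map ArchWeight.a).sum =
      (n : ℂ) * (Fintype.card (K →+* ℂ) : ℂ) * (w : ℂ) := by
  set S : ℂ := ∑ ι : K →+* ℂ, ((T ι).map ArchWeight.a).sum with hS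
  -- re-index by the involution `ι ↦ conj ∘ ι`
  have hinv : Function.Involutive fun ι : K →+* ℂ ↦ (starRingEnd ℂ).comp ι := fun ι ↦
    RingHom.ext fun x ↦ Complex.conj_conj _
  have h1 : ∑ ι : K →+* ℂ, ((T ((starRingEnd ℂ).comp ι)).map ArchWeight.a).sum = S :=
    Equiv.sum_comp hinv.toPerm (fun ι ↦ ((T ι).map ArchWeight.a).sum)
  -- at each embedding, `∑_{a ∈ T ῑ} a = n w − ∑_{a ∈ T ι} a`
  have h2 : ∀ ι : K →+* ℂ, ((T ((starRingEnd ℂ).comp ι)).map ArchWeight.a).sum =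
      (n : ℂ) * (w : ℂ) - ((T ι).map ArchWeight.a).sum := by
    intro ι
    rw [hw ι, Multiset.sum_map_sub, Multiset.map_const', Multiset.sum_replicate, Multiset.map_id',
      Multiset.card_map, hcard ι, nsmul_eq_mul]
  have h3 : ∑ ι : K →+* ℂ, ((T ((starRingEnd ℂ).comp ι)).map ArchWeight.a).sum =
      (Fintype.card (K →+* ℂ) : ℂ) * ((n : ℂ) * (w : ℂ)) - S := by
    rw [Finset.sum_congr rfl fun ι _ ↦ h2 ι, Finset.sum_sub_distrib, Finset.sum_const,
      Finset.card_univ, nsmul_eq_mul]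
  rw [h1] at h3
  linear_combination h3

/-- **The purity weight is unique** (`n ≥ 1`): two integers `w, w'` both satisfying multiset
purity for the same `T` coincide (`n · #(K →+* ℂ) · w = 2 ∑ a = n · #(K →+* ℂ) · w'`).
[cite: Clozel1990, Lemme 4.9] -/
theorem purityWeight_unique {T : InfinityType K n} (hn : n ≠ 0)
    (hcard : ∀ ι : K →+* ℂ, Multiset.card (T ι) = n) {w w' : ℤ}
    (hw : ∀ ι : K →+* ℂ, (T ((starRingEnd ℂ).comp ι)).map ArchWeight.a =
      ((T ι).map ArchWeight.a).map fun a ↦ (w : ℂ) - a)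
    (hw' : ∀ ι : K →+* ℂ, (T ((starRingEnd ℂ).comp ι)).map ArchWeight.a =
      ((T ι).map ArchWeight.a).map fun a ↦ (w' : ℂ) - a) :
    w = w' := by
  have h := two_mul_sum_sum_a_eq_of_pure hcard hw
  rw [two_mul_sum_sum_a_eq_of_pure hcard hw'] at h
  have hn' : (n : ℂ) ≠ 0 := by exact_mod_cast hn
  have hd : (Fintype.card (K →+* ℂ) : ℂ) ≠ 0 := by exact_mod_cast Fintype.card_ne_zero
  exact_mod_cast (mul_left_cancel₀ (mul_ne_zero hn' hd) h).symm

/-- **The total `a`-sum is invariant under `Aut(ℂ)`-conjugation**: if `T'` has the `a`-multisets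
of `^σT = T.autConj σ` at every embedding, then `∑_ι ∑_{a ∈ T' ι} a = ∑_ι ∑_{a ∈ T ι} a`
(re-index by the bijection `ι ↦ σ⁻¹ ∘ ι`). [folklore] -/
theorem sum_sum_a_eq_of_map_a_eq_autConj {T T' : InfinityType K n} (σ : ℂ ≃ₐ[ℚ] ℂ)
    (h : ∀ ι : K →+* ℂ, (T' ι).map ArchWeight.a = (T.autConj σ ι).map ArchWeight.a) :
    ∑ ι : K →+* ℂ, ((T' ι).map ArchWeight.a).sum = ∑ ι : K →+* ℂ, ((T ι).map ArchWeight.a).sum := by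
  let e : (K →+* ℂ) ≃ (K →+* ℂ) :=
    { toFun := fun ι ↦ (σ.symm : ℂ ≃ₐ[ℚ] ℂ).toAlgHom.toRingHom.comp ι
      invFun := fun ι ↦ (σ : ℂ ≃ₐ[ℚ] ℂ).toAlgHom.toRingHom.comp ι
      left_inv := fun ι ↦ RingHom.ext fun x ↦ σ.apply_symm_apply _
      right_inv := fun ι ↦ RingHom.ext fun x ↦ σ.symm_apply_apply _ }
  calc ∑ ι : K →+* ℂ, ((T' ι).map ArchWeight.a).sum
      = ∑ ι : K →+* ℂ, ((T (e ι)).map ArchWeight.a).sum :=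
        Finset.sum_congr rfl fun ι _ ↦ by rw [h ι, InfinityType.autConj_apply]; rfl
    _ = ∑ ι : K →+* ℂ, ((T ι).map ArchWeight.a).sum :=
        Equiv.sum_comp e (fun ι ↦ ((T ι).map ArchWeight.a).sum)

/-- **Conjugate infinity types have the same purity weight** (`n ≥ 1`). If `T` (with `n` weights
at each embedding) is pure of weight `w` and a type `T'` with the `a`-multisets of `^σT` is pure of
weight `w'` (both in the multiset sense), then `w' = w`: both equal `2 ∑ a / (n · #(K →+* ℂ))`, and
the total `a`-sum is the same (`sum_sum_a_eq_of_map_a_eq_autConj`). This is why clause (iii) of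
`Clozel1990_regularAlgebraic` yields ONE weight for `π` and all its `Aut(ℂ)`-conjugates.
[cite: Clozel1990, Lemme 4.9] -/
theorem purityWeight_eq_of_map_a_eq_autConj {T T' : InfinityType K n} (hn : n ≠ 0)
    (hcard : ∀ ι : K →+* ℂ, Multiset.card (T ι) = n) (σ : ℂ ≃ₐ[ℚ] ℂ)
    (h : ∀ ι : K →+* ℂ, (T' ι).map ArchWeight.a = (T.autConj σ ι).map ArchWeight.a) {w w' : ℤ}
    (hw : ∀ ι : K →+* ℂ, (T ((starRingEnd ℂ).comp ι)).map ArchWeight.a =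
      ((T ι).map ArchWeight.a).map fun a ↦ (w : ℂ) - a)
    (hw' : ∀ ι : K →+* ℂ, (T' ((starRingEnd ℂ).comp ι)).map ArchWeight.a =
      ((T' ι).map ArchWeight.a).map fun a ↦ (w' : ℂ) - a) :
    w' = w := by
  have hcard' : ∀ ι : K →+* ℂ, Multiset.card (T' ι) = n := fun ι ↦ by
    rw [← Multiset.card_map ArchWeight.a, h ι, Multiset.card_map, InfinityType.autConj_apply,
      hcard]
  have e := two_mul_sum_sum_a_eq_of_pure hcard hw
  have e' := two_mul_sum_sum_a_eq_of_pure hcard' hw'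
  rw [sum_sum_a_eq_of_map_a_eq_autConj σ h, e] at e'
  have hn' : (n : ℂ) ≠ 0 := by exact_mod_cast hn
  have hd : (Fintype.card (K →+* ℂ) : ℂ) ≠ 0 := by exact_mod_cast Fintype.card_ne_zero
  exact_mod_cast (mul_left_cancel₀ (mul_ne_zero hn' hd) e').symm

end InfinityType

section ConjugateWeight

variable {n : ℕ} {K : Type} [Field K] [NumberField K] {hcpt : isCompact_glFiniteIntegralLevel n K}

/-- **Under the fact, the `Aut(ℂ)`-conjugates of a cuspidal regular algebraic `π` are pure of the
SAME weight** (`n ≥ 1`): for every regular algebraic infinity type `T` of `π`, pure of weight `w`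
on multisets, and every `σ`, clause (ii) gives a cuspidal `σ`-conjugate `π'` with a regular
algebraic infinity type `T'` having the `a`-multisets of `^σT`, clause (iii) for `π'` gives a
weight `w'` for `T'`, and `w' = w` (`InfinityType.purityWeight_eq_of_map_a_eq_autConj`). So the
relation `{ā} = {q_v^{-w} a⁻¹}` expected of `π` and of `^σπ` carries one `w`
(cf. `isTotallyReal_or_isCMField_ratField_of_conj_shadow`). [cite: Clozel1990, Thm. 3.13 and Lemme 4.9] -/
theorem Clozel1990_regularAlgebraic.exists_autConjugate_pure_same_weight
    (h : Clozel1990_regularAlgebraic) (hn : n ≠ 0) (π : CuspidalAutomorphicRepData n K hcpt)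
    {T : InfinityType K n} (hT : π.1.HasInfinityType T) (hreg : T.IsRegularAlgebraic) {w : ℤ}
    (hw : ∀ ι : K →+* ℂ, (T ((starRingEnd ℂ).comp ι)).map ArchWeight.a =
      ((T ι).map ArchWeight.a).map fun a ↦ (w : ℂ) - a)
    (σ : ℂ ≃ₐ[ℚ] ℂ) :
    ∃ (π' : CuspidalAutomorphicRepData n K hcpt) (T' : InfinityType K n),
      IsAutConjugate σ π.1 π'.1 ∧ π'.1.HasInfinityType T' ∧ T'.IsRegularAlgebraic ∧
        (∀ ι : K →+* ℂ, (T' ι).map ArchWeight.a = (T.autConj σ ι).map ArchWeight.a) ∧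
        ∀ ι : K →+* ℂ, (T' ((starRingEnd ℂ).comp ι)).map ArchWeight.a =
          ((T' ι).map ArchWeight.a).map fun a ↦ (w : ℂ) - a := by
  obtain ⟨π', hconj, hT'⟩ := h.exists_autConjugate π ⟨T, hT, hreg⟩ σ
  obtain ⟨T', hT'π, ha⟩ := hT' T hT hreg
  have hreg' : T'.IsRegularAlgebraic :=
    InfinityType.isRegularAlgebraic_of_map_a_eq_autConj hreg hT'π.1 σ ha
  obtain ⟨w', hw'⟩ := h.purity π' hT'π hreg'
  have hweq : w' = w :=
    InfinityType.purityWeight_eq_of_map_a_eq_autConj hn hT.1.1 σ ha hw hw'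
  exact ⟨π', T', hconj, hT'π, hreg', ha, hweq ▸ hw'⟩

end ConjugateWeight

end Literature.NumberTheory.Automorphic
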